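import Summits.QuantumFields.QCD.Theses.NestedDissectionSea
import Literature.MathematicalPhysics.QuantumLattice.TopologicalCriticalMass

/-!
# Stub `stub_pinnedLine` (S4) of line `cells-inherit-torus-extinction`, crux `EarlyCrosserLaw`
# (stmt-QuantumFields-13995) — statement certificate: the registered pin IS the crux's (b) ∧ (b″)

The registered stub `stub_pinnedLine` (namespace
`Summit.QuantumFields.QCD.Cruxes.EarlyCrosserLaw.CellsInheritTorusExtinction`) is the TWO-SIDED
PARITY PIN: clauses (b) (lower pin, `P_k,S[Re det D_W(m_crit − a_k M/Z_m) < 0] ≥ 1/4` on every odd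
torus of physical side `≥ R`) and (b″) (upper pin, `… (m_crit + a_k M/Z_m) … ≤ 1/8` on odd tori of
physical side in `[R, 2R]`) of the crux `EarlyCrosserLaw`, under the crux's own prefix
`∀ N_f ∈ {2,3} ∃ reg (HasMassScaling, HasAsymptoticScaling) ∃ M₀ ≥ 0 ∀ m > M₀ ∃ R > 0`, with the
crux's `let`s zeta-expanded and the Wilson measure
`wilsonMeasure (d := 4) (L := 2S+1) (fundamentalRep (Fin 3)) (reg.β k)` spelled by the tree
abbreviation `wilsonMeasureFamily (reg.β k) S` (`TopologicalCriticalMass.lean`), the colour group by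
the tree abbreviation `SU3`.

`pinnedLine_of_earlyCrosserLaw` below is the PROJECTION `EarlyCrosserLaw → stub_pinnedLine`
(drop `b₀`, `ℓ` and clause (a′)); its proof is pure bookkeeping (`obtain` / `exact`), which
certifies that the registered text is definitionally the crux's clauses (b) ∧ (b″) — no
re-wording, no extra hypothesis, same `∃ reg` alignment.  It is NOT a proof of the stub: the pin
itself (topological-charge parity equidistributed on physical tori below the chiral line, and
Mohler–Schaefer's `⟨n_neg⟩ → 0` above it, surviving the continuum limit) is open physics, carried by
the crux.  Standard material [folklore]; no Theses statement is asserted.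
-/

noncomputable section

open Matrix Complex Filter MeasureTheory
open Literature.MathematicalPhysics.QuantumLattice Literature.MathematicalPhysics.QuantumFieldTheory
  Literature.Probability.LatticeModels
open Summit.QuantumFields.QCD.Theses.NestedDissectionSea

namespace Summit.QuantumFields.QCD.Cruxes.EarlyCrosserLaw.CellsInheritTorusExtinction

/-- **The crux projects onto the registered two-sided pin** (`EarlyCrosserLaw → stub_pinnedLine`,
verbatim conclusion): take the crux's `reg`, `M₀`, and for `m > M₀` its `R`; clauses (b), (b″) are
the last two conjuncts, definitionally (the `let`s and the abbreviations `wilsonMeasureFamily`,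
`SU3` unfold by `rfl`). [folklore] -/
theorem pinnedLine_of_earlyCrosserLaw (h : EarlyCrosserLaw) :
    ∀ Nf : ℕ, (Nf = 2 ∨ Nf = 3) → ∃ reg : QCDRegularisation Nf, reg.HasMassScaling ∧
      (reg.scheme 0 0 0).HasAsymptoticScaling ∧ ∃ M₀ : ℝ, 0 ≤ M₀ ∧
      ∀ m : Fin Nf → ℝ, (∀ f, M₀ < m f) → ∃ R : ℝ, 0 < R ∧
        (∀ M : ℝ, M₀ < M → ∀ᶠ k : ℕ in Filter.atTop, ∀ S : ℕ, R ≤ reg.a k * (2 * S + 1) →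
          (1 / 4 : ℝ) ≤
            (∫ U, (if (fermionDet (wilsonDirac (fundamentalRep (Fin 3)) U
                  (reg.mcrit k - reg.a k * M / reg.Zm k) 1)).re < 0 then (1 : ℝ) else 0) *
                (∏ f, ‖fermionDet (wilsonDirac (fundamentalRep (Fin 3)) U
                  (reg.mcrit k + reg.a k * m f / reg.Zm k) 1)‖) ∂(wilsonMeasureFamily (reg.β k) S)) /
            (∫ U, (∏ f, ‖fermionDet (wilsonDirac (fundamentalRep (Fin 3)) U
                  (reg.mcrit k + reg.a k * m f / reg.Zm k) 1)‖) ∂(wilsonMeasureFamily (reg.β k) S))) ∧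
        (∀ M : ℝ, M₀ < M → ∀ᶠ k : ℕ in Filter.atTop, ∀ S : ℕ, R ≤ reg.a k * (2 * S + 1) →
          reg.a k * (2 * S + 1) ≤ 2 * R →
            (∫ U, (if (fermionDet (wilsonDirac (fundamentalRep (Fin 3)) U
                  (reg.mcrit k + reg.a k * M / reg.Zm k) 1)).re < 0 then (1 : ℝ) else 0) *
                (∏ f, ‖fermionDet (wilsonDirac (fundamentalRep (Fin 3)) U
                  (reg.mcrit k + reg.a k * m f / reg.Zm k) 1)‖) ∂(wilsonMeasureFamily (reg.β k) S)) /
            (∫ U, (∏ f, ‖fermionDet (wilsonDirac (fundamentalRep (Fin 3)) U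
                  (reg.mcrit k + reg.a k * m f / reg.Zm k) 1)‖) ∂(wilsonMeasureFamily (reg.β k) S))
              ≤ (1 / 8 : ℝ)) := by
  intro Nf hNf
  obtain ⟨reg, hms, has, M₀, hM₀, b₀, -, ℓ, -, hm⟩ := h Nf hNf
  refine ⟨reg, hms, has, M₀, hM₀, fun m hmm => ?_⟩
  obtain ⟨R, hR, -, hlow, hup⟩ := hm m hmm
  exact ⟨R, hR, hlow, hup⟩

end Summit.QuantumFields.QCD.Cruxes.EarlyCrosserLaw.CellsInheritTorusExtinction

end
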